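import Summits.RiemannHypothesis.RiemannHypothesis.Theorems.UniversalFactorLaguerreCriterion
import Literature.Analysis.SpecialFunctions.GammaVerticalBounds
import Mathlib.Analysis.SpecialFunctions.ImproperIntegrals
import Mathlib.Analysis.SpecificLimits.Basic
import Mathlib.Analysis.Real.Pi.Bounds

/-!
# RiemannHypothesis / UniversalFactor — `MediumKernelNoGo`, stub `stub_H0cosh`:
the cosh-majorisation of `H_0` off the real axis

Route `RiemannHypothesis/UniversalFactor`, crux `MediumKernelNoGo`
(item stmt-RiemannHypothesis-2577), line `one-sided-average-sign-test`.  The certified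
Gauss–Legendre quadrature of the one-sided Laplace averages of `H_0 = deBruijnH 0` needs a sup
bound of `H_0` on discs of radius `≤ 12` around real points; this file supplies it:

* `UniversalFactor.h0cosh_norm_deBruijnH_zero_le` — `‖H_0(z)‖ ≤ ∫₀^∞ Φ(u) cosh(Im z · u) du` for
  every complex `z` (`H_0(z) = ∫₀^∞ Φ(u) cos(zu) du`, `Φ > 0` on `[0, ∞)`,
  `‖cos(zu)‖ ≤ cosh(Im z · u)`);
* `UniversalFactor.h0cosh_integrableOn_phi_mul_cosh` — `Φ(u) cosh(yu)` is integrable on `(0, ∞)`;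
* `UniversalFactor.h0cosh_integral_le_five` — `∫₀^∞ Φ(u) cosh(12u) du ≤ 5`, from
  `Φ(u) ≤ (∑ M_n) e^{9u − πe^{4u}}` with `∑ M_n ≤ 20π²/3`, `cosh(12u) ≤ e^{12u}` and
  `21u − πe^{4u} ≤ −3/2 − 4u` (so the integrand is `≤ (20π²/3) e^{−3/2} e^{−4u}`, whose integral is
  `(5π²/3) e^{−3/2} < 5`);
* `UniversalFactor.stub_H0cosh` — the registered conjunction of the three.

References: standard real analysis; Rodgers–Tao 2020, §1 (decay of `Φ`).
-/

set_option linter.dupNamespace false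

noncomputable section

namespace Summit.RiemannHypothesis.RiemannHypothesis.Theorems

open MeasureTheory Set Complex
open Literature.NumberTheory.LFunctions

/-! ## Elementary inequalities -/

/-- Termwise geometric bound of the majorant: `M_n ≤ 5π² · 4^{−n}` (since `(n+1)⁴ ≤ e^{4n}`,
`π − π(n+1)² ≤ −6n` and `e^{−2} ≤ 1/4`). [folklore] -/
theorem UniversalFactor.h0cosh_majorant_le (n : ℕ) :
    deBruijnPhiMajorant n ≤ 5 * Real.pi ^ 2 * (1 / 4) ^ n := by
  unfold deBruijnPhiMajorant
  have hn : (0:ℝ) ≤ n := Nat.cast_nonneg n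
  have h1 : ((n:ℝ) + 1) ^ 4 ≤ Real.exp (4 * n) := by
    have h := Real.add_one_le_exp (n:ℝ)
    calc ((n:ℝ) + 1) ^ 4 ≤ (Real.exp n) ^ 4 := by gcongr
      _ = Real.exp (4 * n) := by rw [← Real.exp_nat_mul]; norm_num
  have h2 : Real.exp Real.pi * Real.exp (-(Real.pi * ((n:ℝ) + 1) ^ 2)) ≤ Real.exp (-(6 * n)) := by
    rw [← Real.exp_add]
    apply Real.exp_monotone
    nlinarith [Real.pi_gt_three, mul_nonneg Real.pi_pos.le (sq_nonneg (n:ℝ)),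
      mul_nonneg (by linarith [Real.pi_gt_three] : (0:ℝ) ≤ 2 * Real.pi - 6) hn]
  have h3 : Real.exp (4 * n) * Real.exp (-(6 * n)) ≤ (1 / 4) ^ n := by
    rw [← Real.exp_add, show (4 * (n:ℝ) + -(6 * n)) = n * (-2) by ring, Real.exp_nat_mul]
    apply pow_le_pow_left₀ (Real.exp_pos _).le
    rw [Real.exp_neg, one_div]
    apply inv_anti₀ (by norm_num)
    have h11 := Real.add_one_le_exp (1:ℝ)
    have h22 : Real.exp 2 = Real.exp 1 * Real.exp 1 := by rw [← Real.exp_add]; norm_num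
    nlinarith [Real.exp_pos (1:ℝ)]
  have h12 := mul_le_mul h1 h2 (by positivity) (Real.exp_pos _).le
  calc 5 * Real.pi ^ 2 * ((n:ℝ) + 1) ^ 4 *
        (Real.exp Real.pi * Real.exp (-(Real.pi * ((n:ℝ) + 1) ^ 2)))
      = 5 * Real.pi ^ 2 * (((n:ℝ) + 1) ^ 4 *
          (Real.exp Real.pi * Real.exp (-(Real.pi * ((n:ℝ) + 1) ^ 2)))) := by ring
    _ ≤ 5 * Real.pi ^ 2 * (Real.exp (4 * n) * Real.exp (-(6 * n))) := by gcongr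
    _ ≤ 5 * Real.pi ^ 2 * (1 / 4) ^ n := by gcongr

/-- The decay constant of `Φ`: `∑ M_n ≤ 5π² · ∑ 4^{−n} = 20π²/3`. [folklore] -/
theorem UniversalFactor.h0cosh_tsum_majorant_le :
    (∑' n, deBruijnPhiMajorant n) ≤ 20 * Real.pi ^ 2 / 3 := by
  have hgeom : Summable (fun n : ℕ => (1 / 4 : ℝ) ^ n) :=
    summable_geometric_of_lt_one (by norm_num) (by norm_num)
  have hq : (1 - 1 / 4 : ℝ)⁻¹ = 4 / 3 := by norm_num
  calc (∑' n, deBruijnPhiMajorant n) ≤ ∑' n : ℕ, 5 * Real.pi ^ 2 * (1 / 4 : ℝ) ^ n :=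
        Summable.tsum_le_tsum UniversalFactor.h0cosh_majorant_le summable_deBruijnPhiMajorant
          (hgeom.mul_left _)
    _ = 5 * Real.pi ^ 2 * ∑' n : ℕ, (1 / 4 : ℝ) ^ n := tsum_mul_left
    _ = 20 * Real.pi ^ 2 / 3 := by
        rw [tsum_geometric_of_lt_one (by norm_num) (by norm_num), hq]; ring

/-- The exponent estimate: for `u ≥ 0`, `9u − πe^{4u} + 12u ≤ −3/2 − 4u`
(from `e^{4u} ≥ 1 + 4u + 8u²` and `π > 3.14`). [folklore] -/
theorem UniversalFactor.h0cosh_exponent_le {u : ℝ} (hu : 0 ≤ u) :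
    9 * u - Real.pi * Real.exp (4 * u) + 12 * u ≤ -(3 / 2) + -(4 * u) := by
  have h1 : 1 + 4 * u + (4 * u) ^ 2 / 2 ≤ Real.exp (4 * u) :=
    Real.quadratic_le_exp_of_nonneg (by linarith)
  have hπ := Real.pi_gt_d2
  nlinarith [mul_le_mul_of_nonneg_left h1 Real.pi_pos.le,
    mul_nonneg (mul_nonneg (by norm_num : (0:ℝ) ≤ 8) Real.pi_pos.le) (sq_nonneg (u - 1 / 4)),
    mul_nonneg (by linarith : (0:ℝ) ≤ 8 * Real.pi - 25) hu]

/-- `e^{−3/2} ≤ 1/4` (from `e^{1/2} ≥ 13/8`). [folklore] -/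
theorem UniversalFactor.h0cosh_exp_neg_three_halves_le : Real.exp (-(3 / 2)) ≤ 1 / 4 := by
  have h1 : (13 / 8 : ℝ) ≤ Real.exp (1 / 2) :=
    calc (13 / 8 : ℝ) = 1 + 1 / 2 + (1 / 2) ^ 2 / 2 := by norm_num
      _ ≤ Real.exp (1 / 2) := Real.quadratic_le_exp_of_nonneg (by norm_num)
  have h3 : Real.exp (3 / 2) = Real.exp (1 / 2) ^ 3 := by
    rw [← Real.exp_nat_mul]; norm_num
  have h4 : (4 : ℝ) ≤ Real.exp (3 / 2) := by
    rw [h3]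
    calc (4:ℝ) ≤ (13 / 8) ^ 3 := by norm_num
      _ ≤ Real.exp (1 / 2) ^ 3 := by gcongr
  rw [Real.exp_neg, one_div]
  exact inv_anti₀ (by norm_num) h4

/-! ## Integrability and the cosh-majorisation -/

/-- `u ↦ Φ(u) cosh(yu)` is integrable on `(0, ∞)` for every real `y` (dominated by
`deBruijnHBound 0 |y|`, as `cosh(yu) ≤ e^{|y|u}` and `|Φ| = Φ` on `u ≥ 0`). [folklore] -/
theorem UniversalFactor.h0cosh_integrableOn_phi_mul_cosh (y : ℝ) :
    IntegrableOn (fun u : ℝ => deBruijnPhi u * Real.cosh (y * u)) (Ioi 0) := by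
  refine (integrableOn_deBruijnHBound 0 |y|).mono' ?_
    (ae_restrict_of_forall_mem measurableSet_Ioi ?_)
  · refine ContinuousOn.aestronglyMeasurable ?_ measurableSet_Ioi
    exact (continuousOn_deBruijnPhi_Ici.mono Ioi_subset_Ici_self).mul
      (Real.continuous_cosh.comp (continuous_const.mul continuous_id)).continuousOn
  · intro u hu
    have hu' : 0 ≤ u := le_of_lt hu
    rw [deBruijnHBound, Real.norm_eq_abs, abs_mul, abs_of_pos (Real.cosh_pos _), zero_mul,
      Real.exp_zero, one_mul]
    gcongr
    calc Real.cosh (y * u) ≤ Real.exp |y * u| :=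
          Literature.Analysis.Complex.DeBruijn1950.cosh_le_exp_abs _
      _ = Real.exp (|y| * u) := by rw [abs_mul, abs_of_nonneg hu']

/-- **cosh-majorisation of `H_0`**: `‖H_0(z)‖ ≤ ∫₀^∞ Φ(u) cosh(Im z · u) du` for every complex `z`.
[folklore] -/
theorem UniversalFactor.h0cosh_norm_deBruijnH_zero_le (z : ℂ) :
    ‖deBruijnH 0 z‖ ≤ ∫ u in Ioi (0:ℝ), deBruijnPhi u * Real.cosh (z.im * u) := by
  rw [deBruijnH_zero_eq_integral_cos z]
  refine norm_integral_le_of_norm_le (UniversalFactor.h0cosh_integrableOn_phi_mul_cosh z.im)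
    (ae_restrict_of_forall_mem measurableSet_Ioi fun u hu => ?_)
  rw [norm_mul, Complex.norm_real, Real.norm_eq_abs,
    abs_of_pos (deBruijnPhi_pos_of_nonneg (le_of_lt hu))]
  refine mul_le_mul_of_nonneg_left ?_ (deBruijnPhi_pos_of_nonneg (le_of_lt hu)).le
  calc ‖Complex.cos (z * u)‖ ≤ Real.cosh (z * u).im :=
        Literature.Analysis.SpecialFunctions.GammaVert.norm_cos_le_cosh_im _
    _ = Real.cosh (z.im * u) := by simp [Complex.mul_im]

/-! ## The explicit strip constant `∫₀^∞ Φ(u) cosh(12u) du ≤ 5` -/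

/-- Pointwise: `Φ(u) cosh(12u) ≤ (20π²/3) e^{−3/2} · e^{−4u}` for `u ≥ 0`. [folklore] -/
theorem UniversalFactor.h0cosh_integrand_le {u : ℝ} (hu : 0 ≤ u) :
    deBruijnPhi u * Real.cosh (12 * u) ≤
      (20 * Real.pi ^ 2 / 3 * Real.exp (-(3 / 2))) * Real.exp (-4 * u) := by
  have hΦ : deBruijnPhi u ≤
      (20 * Real.pi ^ 2 / 3) * Real.exp (9 * u - Real.pi * Real.exp (4 * u)) := by
    have h := abs_deBruijnPhi_le hu
    rw [abs_of_pos (deBruijnPhi_pos_of_nonneg hu)] at h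
    refine h.trans ?_
    gcongr
    exact UniversalFactor.h0cosh_tsum_majorant_le
  have hcosh : Real.cosh (12 * u) ≤ Real.exp (12 * u) := by
    have := Literature.Analysis.Complex.DeBruijn1950.cosh_le_exp_abs (12 * u)
    rwa [abs_of_nonneg (by linarith)] at this
  calc deBruijnPhi u * Real.cosh (12 * u)
      ≤ (20 * Real.pi ^ 2 / 3) * Real.exp (9 * u - Real.pi * Real.exp (4 * u)) *
          Real.exp (12 * u) :=
        mul_le_mul hΦ hcosh (Real.cosh_pos _).le (by positivity)
    _ = (20 * Real.pi ^ 2 / 3) * Real.exp (9 * u - Real.pi * Real.exp (4 * u) + 12 * u) := by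
        rw [mul_assoc, ← Real.exp_add]
    _ ≤ (20 * Real.pi ^ 2 / 3) * Real.exp (-(3 / 2) + -(4 * u)) :=
        mul_le_mul_of_nonneg_left (Real.exp_le_exp.2 (UniversalFactor.h0cosh_exponent_le hu))
          (by positivity)
    _ = (20 * Real.pi ^ 2 / 3 * Real.exp (-(3 / 2))) * Real.exp (-4 * u) := by
        rw [Real.exp_add, neg_mul, mul_assoc]

/-- **The strip constant**: `∫₀^∞ Φ(u) cosh(12u) du ≤ 5` (true value `H_0(12i) ≈ 0.14`).
[folklore] -/
theorem UniversalFactor.h0cosh_integral_le_five :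
    (∫ u in Ioi (0:ℝ), deBruijnPhi u * Real.cosh (12 * u)) ≤ 5 := by
  have hint : IntegrableOn
      (fun u : ℝ => (20 * Real.pi ^ 2 / 3 * Real.exp (-(3 / 2))) * Real.exp (-4 * u)) (Ioi 0) :=
    (integrableOn_exp_mul_Ioi (by norm_num) 0).const_mul _
  have hle : (∫ u in Ioi (0:ℝ), deBruijnPhi u * Real.cosh (12 * u)) ≤
      ∫ u in Ioi (0:ℝ), (20 * Real.pi ^ 2 / 3 * Real.exp (-(3 / 2))) * Real.exp (-4 * u) :=
    setIntegral_mono_on (UniversalFactor.h0cosh_integrableOn_phi_mul_cosh 12) hint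
      measurableSet_Ioi fun u hu => UniversalFactor.h0cosh_integrand_le (le_of_lt hu)
  have hval : (∫ u in Ioi (0:ℝ), (20 * Real.pi ^ 2 / 3 * Real.exp (-(3 / 2))) * Real.exp (-4 * u)) =
      5 / 3 * (Real.pi ^ 2 * Real.exp (-(3 / 2))) := by
    rw [integral_const_mul, integral_exp_mul_Ioi (by norm_num) 0]
    norm_num
    ring
  rw [hval] at hle
  refine hle.trans ?_
  have hπ : Real.pi ^ 2 < 10 := by nlinarith [Real.pi_lt_d2, Real.pi_pos]
  have hprod : Real.pi ^ 2 * Real.exp (-(3 / 2)) ≤ 10 * (1 / 4) :=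
    mul_le_mul hπ.le UniversalFactor.h0cosh_exp_neg_three_halves_le (Real.exp_pos _).le
      (by norm_num)
  linarith

/-! ## The registered stub -/

/-- **STUB `stub_H0cosh`** of the line `one-sided-average-sign-test` for `MediumKernelNoGo`
(item stmt-RiemannHypothesis-2577): `‖H_0(z)‖ ≤ ∫₀^∞ Φ(u) cosh(Im z · u) du` for all complex `z`,
`Φ(u) cosh(12u)` is integrable on `(0, ∞)`, and `∫₀^∞ Φ(u) cosh(12u) du ≤ 5`. [folklore] -/
theorem UniversalFactor.stub_H0cosh :
    (∀ z : ℂ, ‖deBruijnH 0 z‖ ≤ ∫ u in Ioi (0:ℝ), deBruijnPhi u * Real.cosh (z.im * u)) ∧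
    IntegrableOn (fun u : ℝ => deBruijnPhi u * Real.cosh (12 * u)) (Ioi 0) ∧
    (∫ u in Ioi (0:ℝ), deBruijnPhi u * Real.cosh (12 * u)) ≤ 5 :=
  ⟨UniversalFactor.h0cosh_norm_deBruijnH_zero_le,
    UniversalFactor.h0cosh_integrableOn_phi_mul_cosh 12, UniversalFactor.h0cosh_integral_le_five⟩

end Summit.RiemannHypothesis.RiemannHypothesis.Theorems

end
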